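import Literature.Probability.Percolation.OneArmPivotalLayerSub
import Literature.Probability.Percolation.HalfPlaneTwoArmRadiiNearCritical
import HarnessLib

/-!
# The one-arm pivotal sum with a GENERIC local four-arm factor, on both sides of `1/2` (proofs only)

Topic `Literature/Probability/Percolation`; family `crit-perc`, statement **crit-perc.S16**
(`Literature.Probability.Percolation.triTheta_exponent`); serves the discharge of
`Literature.Probability.Percolation.Nolin2008_thm27_oneArm` (Nolin 2008, Thm. 27, `j = 1`).
PROOFS ONLY (no definition, no named fact).

`OneArmPivotalSum.lean`, `OneArmPivotalSumSub.lean` and `OneArmPivotalLayerSub.lean` prove Werner's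
bound (C) `Σ_v P_t(v pivotal for 0 ↔ ∂Λ_N) ≤ C N² π̂_t(r₀, N) P_t(0 ↔ ∂Λ_N)` (W. Werner, PCMI 2009,
Lecture 6, §5; P. Nolin, EJP 13 (2008), §6.2, proof of Thm. 27, Case 1 [arXiv 0711.4948: Thm. 26])
with the local four-arm factor `π̂ = fourArmProbAt` (the tree's ORDER-FREE four-arm event) and the
named facts `Werner2009_fourArm_quasiMult`, `Werner2009_fourArm_lowerBound` stated for it. Those
proofs use `π̂` only as a black box: a non-negative kernel `q(r, R)`, non-increasing in `R`,
entering through (i) the per-site three-factor bounds `P_t(v pivotal) ≤ P_t(0 ↔ ∂Λ_m) · q(r₀, d) ·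
P_t(∂Λ_{m'} ↝ ∂Λ_N)` (bulk) and `P_t(v pivotal) ≤ P_t(0 ↔ ∂Λ_{m₀}) · q(r₀, d') · P_t(B_{T,F})`
(boundary layer), (ii) quasi-multiplicativity `c_Q q(r₀, R) q(4R, S) ≤ q(r₀, S)` and (iii) the a
priori lower bound `c_L (m/n)^{2-β} ≤ q(m, n)`. This file re-proves the whole of (C), on both
sides of `1/2`, for an ARBITRARY kernel with these properties as explicit hypotheses, so that it
applies verbatim to Werner's ALTERNATING `π̂^alt = altFourArmProbAt` (`AltFourArm.lean`; per-site
bounds `measureReal_isPivotal_triOneArm_le_alt`, `boundary_pivotal_three_le_mixed_alt` of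
`CutPointAltArms.lean`, `OneArmBoundaryAltArms.lean`), for which Kesten's arm calculus is
developed in the literature one colour sequence at a time (Nolin 2008, §4; Werner 2009, Lecture 6,
§4), as well as to the order-free `π̂` (recovering the tree's statements). The half-plane two-arm
input of the boundary layer is the theorem `Werner2009_halfPlane_twoArm_holds`
(`HalfPlaneTwoArmRadiiNearCritical.lean`), used two-sidedly.

Contents (each proof is that of the named tree lemma, with `fourArmProbAt t` replaced by the
kernel and its two properties invoked where `fourArmProbAt_nonneg` / `fourArmProbAt_anti` were):

* `kernel_le_ratio_mul` (← `fourArmProbAt_le_ratio_mul`): `q(r₀, d) ≤ (4/(c_Q c_L)) (N/d)^{2-β} q(r₀, N)`;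
* `pivotal_bound_inner_gen`, `pivotal_bound_mid_gen`, `pivotal_bound_small_gen`
  (← `pivotal_bound_inner'/mid'/small'`);
* `oneArmPivotalSum_bulk_le_twoSided_gen` (← `oneArmPivotalSum_bulk_le_twoSided`),
  `oneArmPivotalSum_layer_le_twoSided_gen` (← `oneArmPivotalSum_layer_le_twoSided`),
  `oneArmPivotalSum_le_twoSided_gen` (← `oneArmPivotalSum_le_twoSided`): for a kernel
  `Q t r R` with the per-site bounds at every `t`, and two-sided quasi-multiplicativity / lower
  bound below `L(t, ε)` in `∀∃` form,
  `Σ_{v ∈ Λ_N} P_t(v pivotal) ≤ C · N² Q_t(r₀, N) · P_t(0 ↔ ∂Λ_N)` for `|t - 1/2| < δ`, `t ≠ 1/2`,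
  `n₁ ≤ N`, `4N ≤ L_ε(t)`.

## References

* W. Werner, *Lectures on two-dimensional critical percolation*, IAS/Park City Math. Ser. 16
  (2009), Lecture 6, §3, §4 (Cor. 6.2), proof of Lemma 6.2 and §5 [WernerPCMI2009].
* P. Nolin, Near-critical percolation in two dimensions, *Electron. J. Probab.* 13 (2008), §6.2,
  proof of Thm. 27, Case 1, eqs. (6.6)–(6.9); §4.6 [arXiv 0711.4948: Thm. 26] [Nolin2008].
* H. Kesten, Scaling relations for 2D-percolation, *Comm. Math. Phys.* 109 (1987), Lemma 8
  [KestenScalingCMP1987].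

Tree: `inner_outer_le'`, `extend_twice_le'` (`OneArmPivotalSumSub.lean`), `measureReal_isPivotal_le_div`,
`card_triSphere_le`, `sum_triBall_eq_sum_triSphere`, `sum_shell_weight_le`, `div_rpow_two_sub`
(`OneArmPivotalSum.lean`), `layer_ratio_le`, `layer_ratio_le'`, `layer_sum_deep_le`, `layer_sum_shallow_le`
(`OneArmPivotalLayer.lean`), `boundary_pivotal_two_le_mixed`, `Werner2009_halfPlane_twoArm.two_sided`
(`OneArmBoundaryArmsMixed.lean`), `Werner2009_halfPlane_twoArm_holds` (`HalfPlaneTwoArmRadiiNearCritical.lean`),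
`triOneArm_quasiMult_nearCritical`, `triOneArm_extend_nearCritical` (`OneArmQuasiMultNearCritical.lean`),
`charLength_le_charLengthW` (`WernerCorrelationLengthProofs.lean`), `oneArmPivotalSum`
(`WernerPivotalEstimates.lean`). Mathlib: `Real.rpow` API, `Finset.sum_Ico_consecutive`.
-/

noncomputable section

open MeasureTheory Set Finset Real
open scoped unitInterval

namespace Literature.Probability.Percolation

open LatticeModels

/-! ### The ratio bound for a kernel -/

/-- **The ratio bound for a kernel** (Werner 2009, Lecture 6, proof of Lemma 6.2:
"`π̂(2^j) ≤ c (n/2^j)^{2-β} π̂(n)`"; the tree's `fourArmProbAt_le_ratio_mul` for an arbitrary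
non-negative kernel `q`, non-increasing in the outer radius): from quasi-multiplicativity
`c_Q q(r₀, R) q(4R, S) ≤ q(r₀, S)` and the lower bound `c_L (m/n)^{2-β} ≤ q(m, n)` at the radii
`≤ N`, for `d ≥ 4r₀ + 1`, `d ≥ r_L`, `d ≤ N`, `N ≥ 20 r₀ + 10`, `N ≥ 5 r_L + 5`:
`q(r₀, d) ≤ (4 / (c_Q c_L)) (N/d)^{2-β} q(r₀, N)`. [cite: WernerPCMI2009, Lecture 6, proof of Lemma 6.2 (display: π̂(2^j) ≤ c (n/2^j)^(2-β) π̂(n))] -/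
theorem kernel_le_ratio_mul {q : ℕ → ℕ → ℝ} (hq0 : ∀ r R, 0 ≤ q r R)
    (hqa : ∀ r R R', r ≤ R → R ≤ R' → q r R' ≤ q r R) {N r₀ rL : ℕ} {cQ cL β : ℝ} (hcQ : 0 < cQ)
    (hcL : 0 < cL) (hβ : 0 < β) (hβ2 : β ≤ 2)
    (hQ : ∀ R S : ℕ, 16 * r₀ < 4 * R → 4 * R < S → S ≤ N →
      cQ * (q r₀ R * q (4 * R) S) ≤ q r₀ S)
    (hL : ∀ m n : ℕ, rL ≤ m → m ≤ n → n ≤ N → cL * ((m : ℝ) / n) ^ (2 - β) ≤ q m n)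
    (hN : 20 * r₀ + 10 ≤ N) (hN' : 5 * rL + 5 ≤ N) {d : ℕ} (hd : 4 * r₀ + 1 ≤ d) (hd' : rL ≤ d)
    (hdN : d ≤ N) :
    q r₀ d ≤ 4 / (cQ * cL) * ((N : ℝ) / d) ^ (2 - β) * q r₀ N := by
  have hd0 : (0 : ℝ) < d := by exact_mod_cast (show 0 < d by omega)
  have hN0 : (0 : ℝ) < N := by exact_mod_cast (show 0 < N by omega)
  have hNd : (1 : ℝ) ≤ (N : ℝ) / d := by rw [le_div_iff₀ hd0, one_mul]; exact_mod_cast hdN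
  have hexp : (0 : ℝ) ≤ 2 - β := by linarith
  have hratio1 : (1 : ℝ) ≤ ((N : ℝ) / d) ^ (2 - β) := Real.one_le_rpow hNd hexp
  have hπN : 0 ≤ q r₀ N := hq0 r₀ N
  by_cases h4 : 4 * d < N
  · -- quasi-multiplicativity at `(r₀, d, N)` and the lower bound at `(4d, N)`
    have h1 := hQ d N (by omega) h4 le_rfl
    have h2 := hL (4 * d) N (by omega) (by omega) le_rfl
    have hbase : (0 : ℝ) < ((4 * d : ℕ) : ℝ) / N := by
      apply div_pos _ hN0; exact_mod_cast (show 0 < 4 * d by omega)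
    have hpow : 0 < (((4 * d : ℕ) : ℝ) / N) ^ (2 - β) := Real.rpow_pos_of_pos hbase _
    have hπ4 : 0 < q (4 * d) N := lt_of_lt_of_le (mul_pos hcL hpow) h2
    -- `π̂(r₀, d) ≤ π̂(r₀, N) / (c_Q π̂(4d, N)) ≤ π̂(r₀, N) / (c_Q c_L (4d/N)^{2-β})`
    have h3 : q r₀ d ≤ q r₀ N / (cQ * q (4 * d) N) := by
      rw [le_div_iff₀ (mul_pos hcQ hπ4)]
      calc q r₀ d * (cQ * q (4 * d) N)
          = cQ * (q r₀ d * q (4 * d) N) := by ring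
        _ ≤ q r₀ N := h1
    have h5 : q r₀ N / (cQ * q (4 * d) N) ≤
        q r₀ N / (cQ * (cL * (((4 * d : ℕ) : ℝ) / N) ^ (2 - β))) :=
      div_le_div_of_nonneg_left hπN (mul_pos hcQ (mul_pos hcL hpow))
        (mul_le_mul_of_nonneg_left h2 hcQ.le)
    -- `(4d/N)^{-(2-β)} ≤ (N/d)^{2-β}` and `1 ≤ 4`
    have h6 : (((N : ℝ) / d) ^ (2 - β))⁻¹ ≤ (((4 * d : ℕ) : ℝ) / N) ^ (2 - β) := by
      rw [← Real.inv_rpow (by positivity), inv_div]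
      apply Real.rpow_le_rpow (by positivity) _ hexp
      rw [div_le_div_iff₀ hN0 hN0]
      push_cast; nlinarith
    calc q r₀ d
        ≤ q r₀ N / (cQ * (cL * (((4 * d : ℕ) : ℝ) / N) ^ (2 - β))) := h3.trans h5
      _ = (1 / (cQ * cL)) * ((((4 * d : ℕ) : ℝ) / N) ^ (2 - β))⁻¹ * q r₀ N := by
          field_simp
      _ ≤ (1 / (cQ * cL)) * ((N : ℝ) / d) ^ (2 - β) * q r₀ N := by
          apply mul_le_mul_of_nonneg_right _ hπN
          apply mul_le_mul_of_nonneg_left _ (by positivity)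
          rw [inv_le_comm₀ hpow (by positivity)]
          exact h6
      _ ≤ 4 / (cQ * cL) * ((N : ℝ) / d) ^ (2 - β) * q r₀ N := by
          apply mul_le_mul_of_nonneg_right _ hπN
          apply mul_le_mul_of_nonneg_right _ (by positivity)
          rw [div_le_div_iff_of_pos_right (mul_pos hcQ hcL)]; norm_num
  · -- `d ≥ N/4`: go through `R' = ⌊N/5⌋`
    push Not at h4
    set R' : ℕ := N / 5 with hR'
    have hR'1 : 4 * R' < N := by omega
    have hR'2 : 16 * r₀ < 4 * R' := by omega
    have hR'3 : rL ≤ 4 * R' := by omega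
    have hR'd : R' ≤ d := by omega
    have h1 := hQ R' N hR'2 hR'1 le_rfl
    have h2 := hL (4 * R') N hR'3 (by omega) le_rfl
    -- `(4R'/N)^{2-β} ≥ (1/2)^{2-β} ≥ 1/4`
    have hhalf : (1 : ℝ) / 2 ≤ ((4 * R' : ℕ) : ℝ) / N := by
      rw [div_le_div_iff₀ (by norm_num) hN0]
      have : (N : ℝ) ≤ 2 * ((4 * R' : ℕ) : ℝ) := by
        have h' : N ≤ 2 * (4 * R') := by omega
        exact_mod_cast h'
      linarith
    have hq : (1 : ℝ) / 4 ≤ (((4 * R' : ℕ) : ℝ) / N) ^ (2 - β) := by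
      calc (1 : ℝ) / 4 = (1 / 2) ^ (2 : ℝ) := by norm_num
        _ ≤ (1 / 2 : ℝ) ^ (2 - β) :=
            Real.rpow_le_rpow_of_exponent_ge (by norm_num) (by norm_num) (by linarith)
        _ ≤ (((4 * R' : ℕ) : ℝ) / N) ^ (2 - β) := Real.rpow_le_rpow (by norm_num) hhalf hexp
    have hπ4 : cL / 4 ≤ q (4 * R') N := by
      calc cL / 4 = cL * (1 / 4) := by ring
        _ ≤ cL * (((4 * R' : ℕ) : ℝ) / N) ^ (2 - β) := mul_le_mul_of_nonneg_left hq hcL.le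
        _ ≤ q (4 * R') N := h2
    have hπ4pos : 0 < q (4 * R') N := lt_of_lt_of_le (by positivity) hπ4
    have h3 : q r₀ R' ≤ q r₀ N / (cQ * q (4 * R') N) := by
      rw [le_div_iff₀ (mul_pos hcQ hπ4pos)]
      calc q r₀ R' * (cQ * q (4 * R') N)
          = cQ * (q r₀ R' * q (4 * R') N) := by ring
        _ ≤ q r₀ N := h1
    calc q r₀ d ≤ q r₀ R' := hqa _ _ _ (by omega) hR'd
      _ ≤ q r₀ N / (cQ * q (4 * R') N) := h3
      _ ≤ q r₀ N / (cQ * (cL / 4)) :=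
          div_le_div_of_nonneg_left hπN (by positivity) (mul_le_mul_of_nonneg_left hπ4 hcQ.le)
      _ = 4 / (cQ * cL) * 1 * q r₀ N := by field_simp
      _ ≤ 4 / (cQ * cL) * ((N : ℝ) / d) ^ (2 - β) * q r₀ N := by
          apply mul_le_mul_of_nonneg_right _ hπN
          exact mul_le_mul_of_nonneg_left hratio1 (by positivity)

/-! ### The three regimes of the bulk, generic kernel -/

section Regimes

variable {t : unitInterval} {q : ℕ → ℕ → ℝ} {N r₀ rL : ℕ} {c c' cQ cL β : ℝ}

/-- **Inner bulk, generic kernel** (the tree's `pivotal_bound_inner'` for a kernel `q` with the per-site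
three-factor bound `hpiv`):
for `|v|_𝕋 = k` with `3430 ≤ k`, `8 max(4r₀+1, r_L) ≤ k`, `k + 1 ≤ 0.32 N`,
`P_t(v pivotal for 0 ↔ ∂Λ_N) ≤ (324 / (c c' c_Q c_L)) (N/k)^{2-β} π̂_t(r₀, N) P_t(0 ↔ ∂Λ_N)`. [cite: WernerPCMI2009, Lecture 6, §5 ("Using differential inequalities for the one-arm event")] -/
theorem pivotal_bound_inner_gen (hq0 : ∀ r R, 0 ≤ q r R)
    (hqa : ∀ r R R', r ≤ R → R ≤ R' → q r R' ≤ q r R)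
    (hpiv : ∀ {d m m' k : ℕ} {v : Site 2}, 1 ≤ r₀ → r₀ ≤ d → triNorm v = k → 2 * d + 1 ≤ k →
      k + 2 * d ≤ N → m + d + 1 ≤ k → k + d + 1 ≤ m' → m' ≤ N →
      (triSitePercolation t).real {ω | IsPivotal (triOneArm N) v ω} ≤
        (triSitePercolation t).real (triOneArm m) * (q r₀ d * (triSitePercolation t).real (armEvent ![true] m' N)))
    (hc : 0 < c) (hc' : 0 < c') (hcQ : 0 < cQ) (hcL : 0 < cL)
    (hβ : 0 < β) (hβ2 : β ≤ 2)
    (hq : ∀ a : ℕ, 1000 ≤ a → a ≤ N → ∀ m : ℕ, 3 * a ≤ m → ∀ R : ℝ, 8 * (a : ℝ) ≤ R →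
      ∀ n : ℕ, (n : ℝ) ≤ R →
        c * ((triSitePercolation t).real (triOneArm m) *
          (triSitePercolation t).real (triOpenCrossing (4 * a) R)) ≤
          (triSitePercolation t).real (triOneArm n))
    (hext : ∀ a : ℕ, 1000 ≤ a → a ≤ N → ∀ m n : ℕ, 3 * a ≤ m → n ≤ 8 * a →
      c' * (triSitePercolation t).real (triOneArm m) ≤ (triSitePercolation t).real (triOneArm n))
    (hQ : ∀ R S : ℕ, 16 * r₀ < 4 * R → 4 * R < S → S ≤ N →
      cQ * (q r₀ R * q (4 * R) S) ≤ q r₀ S)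
    (hL : ∀ m n : ℕ, rL ≤ m → m ≤ n → n ≤ N → cL * ((m : ℝ) / n) ^ (2 - β) ≤ q m n)
    (hr₀ : 1 ≤ r₀) (hN : 8000 ≤ N) (hNr : 20 * r₀ + 10 ≤ N) (hNL : 5 * rL + 5 ≤ N)
    {v : Site 2} {k : ℕ} (hk : triNorm v = k) (hk1 : 3430 ≤ k) (hk2 : 8 * (4 * r₀ + 1) ≤ k)
    (hk3 : 8 * rL ≤ k) (hkN : k + 1 ≤ 32 * N / 100) :
    (triSitePercolation t).real {ω | IsPivotal (triOneArm N) v ω} ≤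
      324 / (c * c' * cQ * cL) * ((N : ℝ) / k) ^ (2 - β) *
        (q r₀ N * (triSitePercolation t).real (triOneArm N)) := by
  set d : ℕ := k / 8 with hd
  set m : ℕ := k - d - 1 with hm
  set m' : ℕ := k + d + 1 with hm'
  have hdr : 4 * r₀ + 1 ≤ d := by omega
  have hdL : rL ≤ d := by omega
  have hdN : d ≤ N := by omega
  have hk0 : (0 : ℝ) < k := by exact_mod_cast (show 0 < k by omega)
  have hN0 : (0 : ℝ) < N := by exact_mod_cast (show 0 < N by omega)
  have hd0 : (0 : ℝ) < d := by exact_mod_cast (show 0 < d by omega)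
  have hexp : (0 : ℝ) ≤ 2 - β := by linarith
  -- the three-event bound
  have h1 := hpiv (m := m) (m' := m') hr₀ (by omega : r₀ ≤ d) hk (by omega) (by omega) (by omega)
    (by omega) (by omega)
  -- glue inner and outer arm
  have h2 := inner_outer_le' hc hc' hq hext hN hk1 hkN hd (m := m) (m' := m') (by omega) rfl
  -- the local four-arm factor
  have h3 := kernel_le_ratio_mul hq0 hqa hcQ hcL hβ hβ2 hQ hL hNr hNL hdr hdL hdN
  -- `N/d ≤ 9 N/k`
  have h4 : ((N : ℝ) / d) ^ (2 - β) ≤ 81 * ((N : ℝ) / k) ^ (2 - β) := by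
    have hle : (N : ℝ) / d ≤ 9 * ((N : ℝ) / k) := by
      rw [div_le_iff₀ hd0, mul_div_assoc', div_mul_eq_mul_div, le_div_iff₀ hk0]
      have hdk : (k : ℝ) ≤ 9 * d := by
        have : k ≤ 9 * d := by omega
        exact_mod_cast this
      nlinarith
    calc ((N : ℝ) / d) ^ (2 - β) ≤ (9 * ((N : ℝ) / k)) ^ (2 - β) :=
          Real.rpow_le_rpow (by positivity) hle hexp
      _ = (9 : ℝ) ^ (2 - β) * ((N : ℝ) / k) ^ (2 - β) := Real.mul_rpow (by norm_num) (by positivity)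
      _ ≤ (9 : ℝ) ^ (2 : ℝ) * ((N : ℝ) / k) ^ (2 - β) := by
          apply mul_le_mul_of_nonneg_right _ (by positivity)
          exact Real.rpow_le_rpow_of_exponent_le (by norm_num) (by linarith)
      _ = 81 * ((N : ℝ) / k) ^ (2 - β) := by norm_num
  have hπN : 0 ≤ q r₀ N := hq0 r₀ N
  calc (triSitePercolation t).real {ω | IsPivotal (triOneArm N) v ω}
      ≤ (triSitePercolation t).real (triOneArm m) *
          (q r₀ d * (triSitePercolation t).real (armEvent ![true] m' N)) := h1
    _ = q r₀ d * ((triSitePercolation t).real (triOneArm m) *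
          (triSitePercolation t).real (armEvent ![true] m' N)) := by ring
    _ ≤ (4 / (cQ * cL) * ((N : ℝ) / d) ^ (2 - β) * q r₀ N) *
          (1 / (c * c') * (triSitePercolation t).real (triOneArm N)) :=
        mul_le_mul h3 h2 (mul_nonneg measureReal_nonneg measureReal_nonneg) (by positivity)
    _ ≤ (4 / (cQ * cL) * (81 * ((N : ℝ) / k) ^ (2 - β)) * q r₀ N) *
          (1 / (c * c') * (triSitePercolation t).real (triOneArm N)) := by
        apply mul_le_mul_of_nonneg_right _ (by positivity)
        apply mul_le_mul_of_nonneg_right _ hπN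
        exact mul_le_mul_of_nonneg_left h4 (by positivity)
    _ = 324 / (c * c' * cQ * cL) * ((N : ℝ) / k) ^ (2 - β) *
          (q r₀ N * (triSitePercolation t).real (triOneArm N)) := by
        field_simp
        ring

/-- **Middle bulk, generic kernel** (the tree's `pivotal_bound_mid'`): for
`0.32 N ≤ k + 1`, `k ≤ 9N/10`,
`P_t(v pivotal) ≤ (1764 / (c'² c_Q c_L)) (N/k)^{2-β} π̂_t(r₀, N) P_t(0 ↔ ∂Λ_N)`. [cite: WernerPCMI2009, Lecture 6, §5 ("Using differential inequalities for the one-arm event")] -/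
theorem pivotal_bound_mid_gen (hq0 : ∀ r R, 0 ≤ q r R)
    (hqa : ∀ r R R', r ≤ R → R ≤ R' → q r R' ≤ q r R)
    (hpiv : ∀ {d m m' k : ℕ} {v : Site 2}, 1 ≤ r₀ → r₀ ≤ d → triNorm v = k → 2 * d + 1 ≤ k →
      k + 2 * d ≤ N → m + d + 1 ≤ k → k + d + 1 ≤ m' → m' ≤ N →
      (triSitePercolation t).real {ω | IsPivotal (triOneArm N) v ω} ≤
        (triSitePercolation t).real (triOneArm m) * (q r₀ d * (triSitePercolation t).real (armEvent ![true] m' N)))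
    (hc' : 0 < c') (hcQ : 0 < cQ) (hcL : 0 < cL) (hβ : 0 < β) (hβ2 : β ≤ 2)
    (hext : ∀ a : ℕ, 1000 ≤ a → a ≤ N → ∀ m n : ℕ, 3 * a ≤ m → n ≤ 8 * a →
      c' * (triSitePercolation t).real (triOneArm m) ≤ (triSitePercolation t).real (triOneArm n))
    (hQ : ∀ R S : ℕ, 16 * r₀ < 4 * R → 4 * R < S → S ≤ N →
      cQ * (q r₀ R * q (4 * R) S) ≤ q r₀ S)
    (hL : ∀ m n : ℕ, rL ≤ m → m ≤ n → n ≤ N → cL * ((m : ℝ) / n) ^ (2 - β) ≤ q m n)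
    (hr₀ : 1 ≤ r₀) (hN : 12000 ≤ N) (hNr : 20 * (4 * r₀ + 1) ≤ N) (hNL : 20 * rL ≤ N)
    {v : Site 2} {k : ℕ} (hk : triNorm v = k) (hk1 : 32 * N / 100 ≤ k + 1) (hk2 : k ≤ 9 * N / 10) :
    (triSitePercolation t).real {ω | IsPivotal (triOneArm N) v ω} ≤
      1764 / (c' ^ 2 * cQ * cL) * ((N : ℝ) / k) ^ (2 - β) *
        (q r₀ N * (triSitePercolation t).real (triOneArm N)) := by
  set d : ℕ := N / 20 with hd
  set m : ℕ := k - d - 1 with hm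
  set m' : ℕ := k + d + 1 with hm'
  have hdr : 4 * r₀ + 1 ≤ d := by omega
  have hdL : rL ≤ d := by omega
  have hdN : d ≤ N := by omega
  have hk0 : (0 : ℝ) < k := by exact_mod_cast (show 0 < k by omega)
  have hN0 : (0 : ℝ) < N := by exact_mod_cast (show 0 < N by omega)
  have hd0 : (0 : ℝ) < d := by exact_mod_cast (show 0 < d by omega)
  have hexp : (0 : ℝ) ≤ 2 - β := by linarith
  have h1 := hpiv (m := m) (m' := m') hr₀ (by omega : r₀ ≤ d) hk (by omega) (by omega) (by omega)
    (by omega) (by omega)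
  have h2 := extend_twice_le' hc' hext hN (m := m) (by omega) (by omega)
  have h3 := kernel_le_ratio_mul hq0 hqa hcQ hcL hβ hβ2 hQ hL (by omega) (by omega) hdr hdL hdN
  have hkN' : (1 : ℝ) ≤ (N : ℝ) / k := by
    rw [le_div_iff₀ hk0, one_mul]; exact_mod_cast (show k ≤ N by omega)
  have h4 : ((N : ℝ) / d) ^ (2 - β) ≤ 441 * ((N : ℝ) / k) ^ (2 - β) := by
    have hle : (N : ℝ) / d ≤ 21 := by
      rw [div_le_iff₀ hd0]
      have : N ≤ 21 * d := by omega
      exact_mod_cast this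
    calc ((N : ℝ) / d) ^ (2 - β) ≤ (21 : ℝ) ^ (2 - β) := Real.rpow_le_rpow (by positivity) hle hexp
      _ ≤ (21 : ℝ) ^ (2 : ℝ) := Real.rpow_le_rpow_of_exponent_le (by norm_num) (by linarith)
      _ = 441 * 1 := by norm_num
      _ ≤ 441 * ((N : ℝ) / k) ^ (2 - β) :=
          mul_le_mul_of_nonneg_left (Real.one_le_rpow hkN' hexp) (by norm_num)
  have hπN : 0 ≤ q r₀ N := hq0 r₀ N
  have hX1 : (triSitePercolation t).real (armEvent ![true] m' N) ≤ 1 := measureReal_le_one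
  calc (triSitePercolation t).real {ω | IsPivotal (triOneArm N) v ω}
      ≤ (triSitePercolation t).real (triOneArm m) *
          (q r₀ d * (triSitePercolation t).real (armEvent ![true] m' N)) := h1
    _ ≤ (triSitePercolation t).real (triOneArm m) * (q r₀ d * 1) := by
        apply mul_le_mul_of_nonneg_left _ measureReal_nonneg
        exact mul_le_mul_of_nonneg_left hX1 (hq0 r₀ d)
    _ = q r₀ d * (triSitePercolation t).real (triOneArm m) := by ring
    _ ≤ (4 / (cQ * cL) * ((N : ℝ) / d) ^ (2 - β) * q r₀ N) *
          (1 / c' ^ 2 * (triSitePercolation t).real (triOneArm N)) :=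
        mul_le_mul h3 h2 measureReal_nonneg (by positivity)
    _ ≤ (4 / (cQ * cL) * (441 * ((N : ℝ) / k) ^ (2 - β)) * q r₀ N) *
          (1 / c' ^ 2 * (triSitePercolation t).real (triOneArm N)) := by
        apply mul_le_mul_of_nonneg_right _ (by positivity)
        apply mul_le_mul_of_nonneg_right _ hπN
        exact mul_le_mul_of_nonneg_left h4 (by positivity)
    _ = 1764 / (c' ^ 2 * cQ * cL) * ((N : ℝ) / k) ^ (2 - β) *
          (q r₀ N * (triSitePercolation t).real (triOneArm N)) := by
        field_simp
        ring

/-- **Small distances, `t ≥ 1/4`, generic kernel** (the tree's `pivotal_bound_small'`): for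
`|v|_𝕋 < K`, `K ≥ r₀ ≥ r_L`, `r₀ ≤ N`, the crude bound `P_t(v pivotal) ≤ P_t(0 ↔ ∂Λ_N)/t ≤ 4 P_t(0 ↔ ∂Λ_N)`
(`measureReal_isPivotal_le_div`) and `π̂_t(r₀, N) ≥ c_L (r₀/N)^{2-β}` give
`P_t(v pivotal) ≤ (4K²/(c_L r₀²)) (N / max(1, |v|))^{2-β} π̂_t(r₀, N) P_t(0 ↔ ∂Λ_N)`. [cite: WernerPCMI2009, Lecture 6, §5 ("Using differential inequalities for the one-arm event")] -/
theorem pivotal_bound_small_gen (ht : 1 / 4 ≤ (t : ℝ)) (hcL : 0 < cL) (hβ : 0 < β) (hβ2 : β ≤ 2)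
    (hL : ∀ m n : ℕ, rL ≤ m → m ≤ n → n ≤ N → cL * ((m : ℝ) / n) ^ (2 - β) ≤ q m n)
    {K : ℕ} (hr₀ : 1 ≤ r₀) (hrL : rL ≤ r₀) (hKr : r₀ ≤ K) (hr₀N : r₀ ≤ N) {v : Site 2}
    (hvK : triNorm v < K) :
    (triSitePercolation t).real {ω | IsPivotal (triOneArm N) v ω} ≤
      4 * (K : ℝ) ^ 2 / (cL * (r₀ : ℝ) ^ 2) * ((N : ℝ) / max 1 (triNorm v : ℝ)) ^ (2 - β) *
        (q r₀ N * (triSitePercolation t).real (triOneArm N)) := by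
  classical
  have hr0 : (0 : ℝ) < r₀ := by exact_mod_cast (show 0 < r₀ by omega)
  have hK0 : (0 : ℝ) < K := by exact_mod_cast (show 0 < K by omega)
  have hN0 : (0 : ℝ) < N := by exact_mod_cast (show 0 < N by omega)
  have hexp : (0 : ℝ) ≤ 2 - β := by linarith
  have hmax1 : (1 : ℝ) ≤ max 1 (triNorm v : ℝ) := le_max_left _ _
  have hmax0 : (0 : ℝ) < max 1 (triNorm v : ℝ) := lt_of_lt_of_le one_pos hmax1
  have hmaxK : max 1 (triNorm v : ℝ) ≤ K := by
    apply max_le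
    · exact_mod_cast (show 1 ≤ K by omega)
    · exact_mod_cast hvK.le
  -- crude bound `P_t(v pivotal) ≤ P_t(A)/t ≤ 4 P_t(A)`
  have ht0 : 0 < (t : ℝ) := by linarith
  have h1 : (triSitePercolation t).real {ω | IsPivotal (triOneArm N) v ω} ≤
      4 * (triSitePercolation t).real (triOneArm N) :=
    calc (triSitePercolation t).real {ω | IsPivotal (triOneArm N) v ω}
        ≤ (triSitePercolation t).real (triOneArm N) / t :=
          measureReal_isPivotal_le_div t ht0 (determinedBy_triOneArm N) (isUpperSet_triOneArm N) v
      _ ≤ (triSitePercolation t).real (triOneArm N) / (1 / 4) :=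
          div_le_div_of_nonneg_left measureReal_nonneg (by norm_num) ht
      _ = 4 * (triSitePercolation t).real (triOneArm N) := by ring
  -- `1 ≤ (K²/(c_L r₀²)) (N/max)^{2-β} π̂(r₀, N)`
  have h2 := hL r₀ N hrL hr₀N le_rfl
  have hratio : ((N : ℝ) / K) ^ (2 - β) ≤ ((N : ℝ) / max 1 (triNorm v : ℝ)) ^ (2 - β) :=
    Real.rpow_le_rpow (by positivity) (div_le_div_of_nonneg_left hN0.le hmax0 hmaxK) hexp
  have hprod : cL * ((r₀ : ℝ) / K) ^ (2 : ℝ) ≤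
      ((N : ℝ) / max 1 (triNorm v : ℝ)) ^ (2 - β) * q r₀ N := by
    have hrK : (r₀ : ℝ) / K ≤ 1 := by rw [div_le_one hK0]; exact_mod_cast hKr
    have hrK0 : (0 : ℝ) < (r₀ : ℝ) / K := div_pos hr0 hK0
    calc cL * ((r₀ : ℝ) / K) ^ (2 : ℝ) ≤ cL * ((r₀ : ℝ) / K) ^ (2 - β) := by
          apply mul_le_mul_of_nonneg_left _ hcL.le
          exact Real.rpow_le_rpow_of_exponent_ge hrK0 hrK (by linarith)
      _ = ((N : ℝ) / K) ^ (2 - β) * (cL * ((r₀ : ℝ) / N) ^ (2 - β)) := by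
          rw [mul_left_comm, ← Real.mul_rpow (by positivity) (by positivity)]
          congr 2
          field_simp
      _ ≤ ((N : ℝ) / max 1 (triNorm v : ℝ)) ^ (2 - β) * q r₀ N :=
          mul_le_mul hratio h2 (by positivity) (by positivity)
  have hsq : ((r₀ : ℝ) / K) ^ (2 : ℝ) = (r₀ : ℝ) ^ 2 / (K : ℝ) ^ 2 := by
    rw [Real.rpow_two, div_pow]
  rw [hsq] at hprod
  have hAN : 0 ≤ (triSitePercolation t).real (triOneArm N) := measureReal_nonneg
  have hkey : (4 : ℝ) ≤ 4 * (K : ℝ) ^ 2 / (cL * (r₀ : ℝ) ^ 2) *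
      (((N : ℝ) / max 1 (triNorm v : ℝ)) ^ (2 - β) * q r₀ N) := by
    have hcr : 0 < cL * (r₀ : ℝ) ^ 2 := by positivity
    rw [mul_comm (4 * (K : ℝ) ^ 2 / (cL * (r₀ : ℝ) ^ 2)), ← mul_div_assoc, le_div_iff₀ hcr]
    have := mul_le_mul_of_nonneg_left hprod (show (0 : ℝ) ≤ 4 * (K : ℝ) ^ 2 by positivity)
    have hK2 : (0 : ℝ) < (K : ℝ) ^ 2 := by positivity
    calc 4 * (cL * (r₀ : ℝ) ^ 2) = 4 * (K : ℝ) ^ 2 * (cL * ((r₀ : ℝ) ^ 2 / (K : ℝ) ^ 2)) := by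
          field_simp
      _ ≤ 4 * (K : ℝ) ^ 2 * (((N : ℝ) / max 1 (triNorm v : ℝ)) ^ (2 - β) * q r₀ N) :=
          this
      _ = ((N : ℝ) / max 1 (triNorm v : ℝ)) ^ (2 - β) * q r₀ N * (4 * (K : ℝ) ^ 2) := by
          ring
  calc (triSitePercolation t).real {ω | IsPivotal (triOneArm N) v ω}
      ≤ 4 * (triSitePercolation t).real (triOneArm N) := h1
    _ ≤ (4 * (K : ℝ) ^ 2 / (cL * (r₀ : ℝ) ^ 2) *
          (((N : ℝ) / max 1 (triNorm v : ℝ)) ^ (2 - β) * q r₀ N)) *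
          (triSitePercolation t).real (triOneArm N) := mul_le_mul_of_nonneg_right hkey hAN
    _ = 4 * (K : ℝ) ^ 2 / (cL * (r₀ : ℝ) ^ 2) * ((N : ℝ) / max 1 (triNorm v : ℝ)) ^ (2 - β) *
          (q r₀ N * (triSitePercolation t).real (triOneArm N)) := by ring

end Regimes

/-! ### The bulk sum on both sides of `1/2`, generic kernel -/

/-- **The one-arm pivotal sum in the bulk, both sides of `1/2`, generic kernel** (the tree's
`oneArmPivotalSum_bulk_le_twoSided` for a kernel `Q`; Werner 2009, Lecture 6, §5;
Nolin 2008, §6.2, proof of Thm. 27, Case 1, eqs. (6.6)–(6.9), "uniformly in `P̂` between `P_p` and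
`P_{1-p}`"): from two-sided quasi-multiplicativity (`hQM2`) and the two-sided a priori lower bound
(`hLB2`) of the kernel, for every small `ε`
and every large inner radius `r₀` there are `n₁`, `δ > 0`, `C` with
`Σ_{v ∈ Λ_{⌊9N/10⌋}} P_t(v pivotal for 0 ↔ ∂Λ_N) ≤ C · N² Q_t(r₀, N) · P_t(0 ↔ ∂Λ_N)` for all
`t ≠ 1/2` with `|t - 1/2| < δ` and `n₁ ≤ N`, `4N ≤ L_ε(t)` (Nolin's length; on the super-critical
side the tree's `oneArmPivotalSum_bulk_le` needs `N ≤ L(t, ε)` only). [cite: WernerPCMI2009, Lecture 6, §5 ("Using differential inequalities for the one-arm event")] [cite: Nolin2008, §6.2, proof of Thm. 27, Case 1 (arXiv 0711.4948: Thm. 26)] -/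
theorem oneArmPivotalSum_bulk_le_twoSided_gen {Q : unitInterval → ℕ → ℕ → ℝ}
    (hQ0 : ∀ t r R, 0 ≤ Q t r R) (hQa : ∀ t r R R', r ≤ R → R ≤ R' → Q t r R' ≤ Q t r R)
    (hpivQ : ∀ (t : unitInterval) {N d r₀ m m' k : ℕ} {v : Site 2}, 1 ≤ r₀ → r₀ ≤ d → triNorm v = k →
      2 * d + 1 ≤ k → k + 2 * d ≤ N → m + d + 1 ≤ k → k + d + 1 ≤ m' → m' ≤ N →
      (triSitePercolation t).real {ω | IsPivotal (triOneArm N) v ω} ≤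
        (triSitePercolation t).real (triOneArm m) * (Q t r₀ d * (triSitePercolation t).real (armEvent ![true] m' N)))
    (hQM2 : ∃ ε₁ > (0 : ℝ), ∀ ⦃ε : ℝ⦄, 0 < ε → ε < ε₁ →
      ∃ r₁ : ℕ, ∃ δ > (0 : ℝ), ∃ c > (0 : ℝ),
        ∀ t : unitInterval, |(t : ℝ) - 1 / 2| < δ →
          ∀ r R S : ℕ, r₁ ≤ r → 16 * r < 4 * R → 4 * R < S →
            ((t : ℝ) ≠ 1 / 2 → S ≤ charLengthW ε t) →
              c * (Q t r R * Q t (4 * R) S) ≤ Q t r S)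
    (hLB2 : ∃ ε₁ > (0 : ℝ), ∀ ⦃ε : ℝ⦄, 0 < ε → ε < ε₁ →
      ∃ r₁ : ℕ, ∃ δ > (0 : ℝ), ∃ β > (0 : ℝ), ∃ c > (0 : ℝ),
        ∀ t : unitInterval, |(t : ℝ) - 1 / 2| < δ →
          ∀ m n : ℕ, r₁ ≤ m → m ≤ n → ((t : ℝ) ≠ 1 / 2 → n ≤ charLengthW ε t) →
            c * ((m : ℝ) / n) ^ (2 - β) ≤ Q t m n) :
    ∃ ε₁ > (0 : ℝ), ∀ ⦃ε : ℝ⦄, 0 < ε → ε < ε₁ →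
      ∃ r₁ : ℕ, ∀ r₀ ≥ r₁, ∃ n₁ : ℕ, ∃ δ > (0 : ℝ), ∃ C : ℝ,
        ∀ t : unitInterval, |(t : ℝ) - 1 / 2| < δ → (t : ℝ) ≠ 1 / 2 →
          ∀ N : ℕ, n₁ ≤ N → 4 * N ≤ charLength ε t →
            ∑ v ∈ triBall (9 * N / 10), (triSitePercolation t).real {ω | IsPivotal (triOneArm N) v ω} ≤
              C * ((N : ℝ) ^ 2 * Q t r₀ N) * (triSitePercolation t).real (triOneArm N) := by
  classical
  obtain ⟨εQ, hεQ, HQ⟩ := hQM2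
  obtain ⟨εL, hεL, HL⟩ := hLB2
  refine ⟨min (min εQ εL) (1 / 2), lt_min (lt_min hεQ hεL) (by norm_num), fun ε hε hε₁ => ?_⟩
  have hεQ' : ε < εQ := hε₁.trans_le ((min_le_left _ _).trans (min_le_left _ _))
  have hεL' : ε < εL := hε₁.trans_le ((min_le_left _ _).trans (min_le_right _ _))
  have hε2 : ε < 1 / 2 := hε₁.trans_le (min_le_right _ _)
  obtain ⟨c, hc, hq⟩ := triOneArm_quasiMult_nearCritical hε hε2
  obtain ⟨c', hc', hext⟩ := triOneArm_extend_nearCritical hε hε2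
  obtain ⟨rQ, δQ, hδQ, cQ, hcQ, hQ⟩ := HQ hε hεQ'
  obtain ⟨rL, δL, hδL, β₀, hβ₀, cL, hcL, hL⟩ := HL hε hεL'
  set β : ℝ := min β₀ 1 with hβdef
  have hβ : 0 < β := lt_min hβ₀ one_pos
  have hβ1 : β ≤ 1 := min_le_right _ _
  have hβ2 : β ≤ 2 := hβ1.trans one_le_two
  have hββ₀ : β ≤ β₀ := min_le_left _ _
  refine ⟨max (max rQ rL) 1, fun r₀ hr₀ => ?_⟩
  have hrQ : rQ ≤ r₀ := ((le_max_left _ _).trans (le_max_left _ _)).trans hr₀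
  have hrL : rL ≤ r₀ := ((le_max_right _ _).trans (le_max_left _ _)).trans hr₀
  have hr1 : 1 ≤ r₀ := (le_max_right _ _).trans hr₀
  obtain ⟨K, hK⟩ : ∃ K : ℕ, K = 8 * (4 * r₀ + 1) + 8 * rL + 3430 := ⟨_, rfl⟩
  -- the constants
  set Cs : ℝ := 4 * (K : ℝ) ^ 2 / (cL * (r₀ : ℝ) ^ 2) with hCs
  set Ci : ℝ := 324 / (c * c' * cQ * cL) with hCi
  set Cm : ℝ := 1764 / (c' ^ 2 * cQ * cL) with hCm
  set Cstar : ℝ := Cs + Ci + Cm with hCstar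
  have hCs0 : 0 < Cs := by
    rw [hCs]; have : (0 : ℝ) < K := by exact_mod_cast (show 0 < K by omega)
    have : (0 : ℝ) < r₀ := by exact_mod_cast (show 0 < r₀ by omega)
    positivity
  have hCi0 : 0 < Ci := by rw [hCi]; positivity
  have hCm0 : 0 < Cm := by rw [hCm]; positivity
  have hCstar0 : 0 < Cstar := by rw [hCstar]; positivity
  refine ⟨max 12000 (20 * (4 * r₀ + 1) + 20 * rL + K), min (min δQ δL) (1 / 4),
    lt_min (lt_min hδQ hδL) (by norm_num), 24 * (1 + 1 / β) * Cstar,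
    fun t htδ htne N hN hNL => ?_⟩
  have hN12 : 12000 ≤ N := (le_max_left _ _).trans hN
  have hN2 : 20 * (4 * r₀ + 1) + 20 * rL + K ≤ N := (le_max_right _ _).trans hN
  have hN0 : (0 : ℝ) < N := by exact_mod_cast (show 0 < N by omega)
  have htQ : |(t : ℝ) - 1 / 2| < δQ := htδ.trans_le ((min_le_left _ _).trans (min_le_left _ _))
  have htL : |(t : ℝ) - 1 / 2| < δL := htδ.trans_le ((min_le_left _ _).trans (min_le_right _ _))
  have ht14 : 1 / 4 ≤ (t : ℝ) := by
    have h := htδ.trans_le (min_le_right _ _)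
    rw [abs_sub_lt_iff] at h
    linarith
  -- `N ≤ L_ε(t) ≤ L(t, ε)`
  have hNLε : N ≤ charLength ε t := le_trans (by omega) hNL
  have hNW : N ≤ charLengthW ε t := hNLε.trans (charLength_le_charLengthW hε htne)
  -- the two facts at `t`, for radii `≤ N`
  have hQt : ∀ R S : ℕ, 16 * r₀ < 4 * R → 4 * R < S → S ≤ N →
      cQ * (Q t r₀ R * Q t (4 * R) S) ≤ Q t r₀ S :=
    fun R S h1 h2 h3 => hQ t htQ r₀ R S hrQ h1 h2 fun _ => h3.trans hNW
  have hLt : ∀ m n : ℕ, rL ≤ m → m ≤ n → n ≤ N →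
      cL * ((m : ℝ) / n) ^ (2 - β) ≤ Q t m n := by
    intro m n h1 h2 h3
    have h := hL t htL m n h1 h2 fun _ => h3.trans hNW
    refine le_trans (mul_le_mul_of_nonneg_left ?_ hcL.le) h
    rcases Nat.eq_zero_or_pos m with hm | hm
    · subst hm
      simp only [CharP.cast_eq_zero, zero_div]
      rw [Real.zero_rpow (ne_of_gt (by linarith))]
      exact Real.rpow_nonneg le_rfl _
    · have hn : 0 < n := by omega
      apply Real.rpow_le_rpow_of_exponent_ge
      · exact div_pos (by exact_mod_cast hm) (by exact_mod_cast hn)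
      · rw [div_le_one (by exact_mod_cast hn)]; exact_mod_cast h2
      · linarith
  -- quasi-multiplicativity and extendability at `t`, for scales `a ≤ N` (`2a, 4a ≤ 4N ≤ L_ε(t)`)
  have hqt : ∀ a : ℕ, 1000 ≤ a → a ≤ N → ∀ m : ℕ, 3 * a ≤ m → ∀ R : ℝ, 8 * (a : ℝ) ≤ R →
      ∀ n : ℕ, (n : ℝ) ≤ R →
        c * ((triSitePercolation t).real (triOneArm m) *
          (triSitePercolation t).real (triOpenCrossing (4 * a) R)) ≤
          (triSitePercolation t).real (triOneArm n) :=
    fun a ha haN m hm R hR n hn => hq t a ha (fun _ => by omega) m hm R hR n hn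
  have hextt : ∀ a : ℕ, 1000 ≤ a → a ≤ N → ∀ m n : ℕ, 3 * a ≤ m → n ≤ 8 * a →
      c' * (triSitePercolation t).real (triOneArm m) ≤ (triSitePercolation t).real (triOneArm n) :=
    fun a ha haN m n hm hn => hext t a ha (fun _ => by omega) m n hm hn
  have hKr : r₀ ≤ K := by omega
  have hKN : K ≤ N := by omega
  have hr₀N : r₀ ≤ N := hKr.trans hKN
  set W : ℝ := Q t r₀ N * (triSitePercolation t).real (triOneArm N) with hWdef
  have hW0 : 0 ≤ W := mul_nonneg (hQ0 t r₀ N) measureReal_nonneg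
  -- the uniform bound for each site of the bulk
  have hunif : ∀ v ∈ triBall (9 * N / 10),
      (triSitePercolation t).real {ω | IsPivotal (triOneArm N) v ω} ≤
        Cstar * ((N : ℝ) / max 1 (triNorm v : ℝ)) ^ (2 - β) * W := by
    intro v hv
    rw [mem_triBall_iff] at hv
    obtain ⟨k, hk⟩ : ∃ k : ℕ, triNorm v = k := ⟨(triNorm v).toNat, by have := triNorm_nonneg v; omega⟩
    have hkM : k ≤ 9 * N / 10 := by omega
    have hpow0 : 0 ≤ ((N : ℝ) / max 1 (triNorm v : ℝ)) ^ (2 - β) := by positivity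
    by_cases hsmall : k < K
    · have hvK : triNorm v < K := by rw [hk]; exact_mod_cast hsmall
      have h := pivotal_bound_small_gen ht14 hcL hβ hβ2 hLt hr1 hrL hKr hr₀N hvK
      refine h.trans ?_
      apply mul_le_mul_of_nonneg_right _ hW0
      apply mul_le_mul_of_nonneg_right _ hpow0
      rw [hCstar]; linarith
    · push Not at hsmall
      have hk1 : (1 : ℝ) ≤ k := by exact_mod_cast (show 1 ≤ k by omega)
      have hmax : max 1 (triNorm v : ℝ) = k := by
        rw [hk]; push_cast; exact max_eq_right hk1
      rw [hmax]
      by_cases hin : k + 1 ≤ 32 * N / 100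
      · have h := pivotal_bound_inner_gen (hQ0 t) (hQa t) (hpivQ t) hc hc' hcQ hcL hβ hβ2 hqt hextt hQt hLt hr1
          (by omega)
          (by omega) (by omega) hk (by omega) (by omega) (by omega) hin
        refine h.trans ?_
        apply mul_le_mul_of_nonneg_right _ hW0
        apply mul_le_mul_of_nonneg_right _ (by positivity)
        rw [hCstar]; linarith
      · push Not at hin
        have h := pivotal_bound_mid_gen (hQ0 t) (hQa t) (hpivQ t) hc' hcQ hcL hβ hβ2 hextt hQt hLt hr1 hN12
          (by omega) (by omega) hk
          (by omega) hkM
        refine h.trans ?_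
        apply mul_le_mul_of_nonneg_right _ hW0
        apply mul_le_mul_of_nonneg_right _ (by positivity)
        rw [hCstar]; linarith
  -- summing the shells
  set M : ℕ := 9 * N / 10 with hM
  have hM1 : 1 ≤ M := by omega
  have hMN : M ≤ N := by omega
  set g : Site 2 → ℝ := fun v => ((N : ℝ) / max 1 (triNorm v : ℝ)) ^ (2 - β) with hg
  have hshell : ∀ k : ℕ, ∑ v ∈ triSphere k, g v ≤
      (12 * (k : ℝ) + 6) * ((N : ℝ) ^ (2 - β) * (max (1 : ℝ) k) ^ (β - 2)) := by
    intro k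
    have hconst : ∀ v ∈ triSphere k, g v = (N : ℝ) ^ (2 - β) * (max (1 : ℝ) k) ^ (β - 2) := by
      intro v hv
      rw [mem_triSphere_iff] at hv
      rw [hg]
      simp only [hv, Int.cast_natCast]
      exact div_rpow_two_sub hN0.le (lt_of_lt_of_le one_pos (le_max_left _ _))
    rw [Finset.sum_congr rfl hconst, Finset.sum_const, nsmul_eq_mul]
    apply mul_le_mul_of_nonneg_right _ (by positivity)
    exact_mod_cast card_triSphere_le k
  have hsumg : ∑ v ∈ triBall M, g v ≤ 24 * (1 + 1 / β) * (N : ℝ) ^ 2 := by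
    rw [sum_triBall_eq_sum_triSphere g M]
    calc ∑ k ∈ Finset.range (M + 1), ∑ v ∈ triSphere k, g v
        ≤ ∑ k ∈ Finset.range (M + 1), (12 * (k : ℝ) + 6) * ((N : ℝ) ^ (2 - β) * (max (1 : ℝ) k) ^ (β - 2)) :=
          Finset.sum_le_sum fun k _ => hshell k
      _ = (N : ℝ) ^ (2 - β) * ∑ k ∈ Finset.range (M + 1), (12 * (k : ℝ) + 6) * (max (1 : ℝ) k) ^ (β - 2) := by
          rw [Finset.mul_sum]; refine Finset.sum_congr rfl fun k _ => ?_; ring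
      _ ≤ (N : ℝ) ^ (2 - β) * (24 * (1 + 1 / β) * (M : ℝ) ^ β) :=
          mul_le_mul_of_nonneg_left (sum_shell_weight_le hβ hβ1 hM1) (by positivity)
      _ ≤ (N : ℝ) ^ (2 - β) * (24 * (1 + 1 / β) * (N : ℝ) ^ β) := by
          apply mul_le_mul_of_nonneg_left _ (by positivity)
          apply mul_le_mul_of_nonneg_left _ (by positivity)
          exact Real.rpow_le_rpow (by positivity) (by exact_mod_cast hMN) hβ.le
      _ = 24 * (1 + 1 / β) * ((N : ℝ) ^ (2 - β) * (N : ℝ) ^ β) := by ring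
      _ = 24 * (1 + 1 / β) * (N : ℝ) ^ 2 := by
          rw [← Real.rpow_add hN0, sub_add_cancel, Real.rpow_two]
  calc ∑ v ∈ triBall M, (triSitePercolation t).real {ω | IsPivotal (triOneArm N) v ω}
      ≤ ∑ v ∈ triBall M, Cstar * g v * W := Finset.sum_le_sum hunif
    _ = Cstar * W * ∑ v ∈ triBall M, g v := by
        rw [Finset.mul_sum]; refine Finset.sum_congr rfl fun v _ => ?_; ring
    _ ≤ Cstar * W * (24 * (1 + 1 / β) * (N : ℝ) ^ 2) :=
        mul_le_mul_of_nonneg_left hsumg (mul_nonneg hCstar0.le hW0)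
    _ = 24 * (1 + 1 / β) * Cstar * ((N : ℝ) ^ 2 * Q t r₀ N) *
          (triSitePercolation t).real (triOneArm N) := by rw [hWdef]; ring

/-! ### The boundary layer on both sides of `1/2`, generic kernel -/

set_option maxHeartbeats 400000 in
/-- **The one-arm pivotal sum over the boundary layer, both sides of `1/2`, generic kernel**
(the tree's `oneArmPivotalSum_layer_le_twoSided` for a kernel `Q`; Werner 2009,
Lecture 6, proof of Lemma 6.2, boundary contributions, with §5 for the one-arm event; Nolin 2008,
§6.2 with §4.6): for every small enough `ε` and every large inner radius `r₀` there are `n₁`,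
`δ > 0`, `C` with `Σ_{9N/10 < |v|_𝕋 ≤ N} P_t(v pivotal for {0 ↔ ∂Λ_N}) ≤ C · N² Q_t(r₀, N) · P_t(0 ↔ ∂Λ_N)`
for `|t - 1/2| < δ`, `t ≠ 1/2`, `n₁ ≤ N`, `4N ≤ L_ε(t)`. Shells at depth `d' ≥ d₀` use the mixed
pair (`hpiv3Q`: `cst N^{2-β} d'^{β-1} Q P` each, the half-plane factor
`P_t(B_{T,F}(2d'+1, D-d')) ≤ CH (2d'+1)/(D-d')` by `Werner2009_halfPlane_twoArm_holds` two-sidedly), the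
`d₀` shells closest to the boundary `boundary_pivotal_two_le_mixed`. [cite: WernerPCMI2009, Lecture 6, proof of Lemma 6.2 (boundary contributions) and §5] [cite: Nolin2008, §6.2 (proof of Thm. 27, Case 1) and §4.6 (arXiv 0711.4948: Thm. 26)] -/
theorem oneArmPivotalSum_layer_le_twoSided_gen {Q : unitInterval → ℕ → ℕ → ℝ}
    (hQ0 : ∀ t r R, 0 ≤ Q t r R) (hQa : ∀ t r R R', r ≤ R → R ≤ R' → Q t r R' ≤ Q t r R)
    (hpiv3Q : ∀ (t : unitInterval) {N D k d' d₂ m₀ r₀ : ℕ} {v : Site 2}, triNorm v = k → k + d' = N →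
      1 ≤ r₀ → r₀ ≤ d' → 2 * d' ≤ k → 1 ≤ D → 2 * D ≤ k → m₀ + D + 1 ≤ k → d' + 1 ≤ d₂ →
      d₂ + 2 * d' + 1 ≤ D →
      (triSitePercolation t).real {ω | IsPivotal (triOneArm N) v ω} ≤
        (triSitePercolation t).real (triOneArm m₀) * (Q t r₀ d' *
          (triSitePercolation t).real (domArmEvent ![true, false] (d₂ + d') (D - d') upperHalfPlane)))
    (hQM2 : ∃ ε₁ > (0 : ℝ), ∀ ⦃ε : ℝ⦄, 0 < ε → ε < ε₁ →
      ∃ r₁ : ℕ, ∃ δ > (0 : ℝ), ∃ c > (0 : ℝ),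
        ∀ t : unitInterval, |(t : ℝ) - 1 / 2| < δ →
          ∀ r R S : ℕ, r₁ ≤ r → 16 * r < 4 * R → 4 * R < S →
            ((t : ℝ) ≠ 1 / 2 → S ≤ charLengthW ε t) →
              c * (Q t r R * Q t (4 * R) S) ≤ Q t r S)
    (hLB2 : ∃ ε₁ > (0 : ℝ), ∀ ⦃ε : ℝ⦄, 0 < ε → ε < ε₁ →
      ∃ r₁ : ℕ, ∃ δ > (0 : ℝ), ∃ β > (0 : ℝ), ∃ c > (0 : ℝ),
        ∀ t : unitInterval, |(t : ℝ) - 1 / 2| < δ →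
          ∀ m n : ℕ, r₁ ≤ m → m ≤ n → ((t : ℝ) ≠ 1 / 2 → n ≤ charLengthW ε t) →
            c * ((m : ℝ) / n) ^ (2 - β) ≤ Q t m n) :
    ∃ ε₁ > (0 : ℝ), ∀ ⦃ε : ℝ⦄, 0 < ε → ε < ε₁ →
      ∃ r₁ : ℕ, ∀ r₀ ≥ r₁, ∃ n₁ : ℕ, ∃ δ > (0 : ℝ), ∃ C : ℝ,
        ∀ t : unitInterval, |(t : ℝ) - 1 / 2| < δ → (t : ℝ) ≠ 1 / 2 →
          ∀ N : ℕ, n₁ ≤ N → 4 * N ≤ charLength ε t →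
            ∑ k ∈ Finset.Ico (9 * N / 10 + 1) (N + 1), ∑ v ∈ triSphere k,
                (triSitePercolation t).real {ω | IsPivotal (triOneArm N) v ω} ≤
              C * ((N : ℝ) ^ 2 * Q t r₀ N) * (triSitePercolation t).real (triOneArm N) := by
  classical
  obtain ⟨εQ, hεQ, HQ⟩ := hQM2
  obtain ⟨εL, hεL, HL⟩ := hLB2
  obtain ⟨εH, hεH, HH⟩ := Werner2009_halfPlane_twoArm_holds.two_sided
  refine ⟨min (min εQ εL) (min εH (1 / 2)), lt_min (lt_min hεQ hεL) (lt_min hεH (by norm_num)),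
    fun ε hε hε₁ => ?_⟩
  have hεQ' : ε < εQ := hε₁.trans_le ((min_le_left _ _).trans (min_le_left _ _))
  have hεL' : ε < εL := hε₁.trans_le ((min_le_left _ _).trans (min_le_right _ _))
  have hεH' : ε < εH := hε₁.trans_le ((min_le_right _ _).trans (min_le_left _ _))
  have hε2 : ε < 1 / 2 := hε₁.trans_le ((min_le_right _ _).trans (min_le_right _ _))
  obtain ⟨rQ, δQ, hδQ, cQ, hcQ, hQ⟩ := HQ hε hεQ'
  obtain ⟨rL, δL, hδL, β₀, hβ₀, cL, hcL, hL⟩ := HL hε hεL'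
  obtain ⟨n₀, δH, hδH, CH, hHP⟩ := HH hε hεH'
  obtain ⟨c', hc', hext⟩ := triOneArm_extend_nearCritical hε hε2
  set β : ℝ := min β₀ 1 with hβdef
  have hβ : 0 < β := lt_min hβ₀ one_pos
  have hβ1 : β ≤ 1 := min_le_right _ _
  have hβ2 : β ≤ 2 := hβ1.trans one_le_two
  have hββ₀ : β ≤ β₀ := min_le_left _ _
  have hCH0 : 0 ≤ CH := by
    have hhalf : |((half : unitInterval) : ℝ) - 1 / 2| < δH := by
      rw [coe_half, sub_self, abs_zero]; exact hδH
    have h := hHP half hhalf (max n₀ 1) (max n₀ 1) (le_max_left _ _) le_rfl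
      fun hne => absurd coe_half hne
    have hne : ((max n₀ 1 : ℕ) : ℝ) ≠ 0 := Nat.cast_ne_zero.2 (by omega)
    rw [div_self hne, mul_one] at h
    exact measureReal_nonneg.trans h
  refine ⟨max (max rQ rL) 1, fun r₀ hr₀ => ?_⟩
  have hrQ : rQ ≤ r₀ := ((le_max_left _ _).trans (le_max_left _ _)).trans hr₀
  have hrL : rL ≤ r₀ := ((le_max_right _ _).trans (le_max_left _ _)).trans hr₀
  have hr1 : 1 ≤ r₀ := (le_max_right _ _).trans hr₀
  obtain ⟨d₀, hd₀⟩ : ∃ d₀ : ℕ, d₀ = 4 * r₀ + 1 + rL + n₀ := ⟨_, rfl⟩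
  -- constants
  set K₁ : ℝ := 44 * CH / (c' * (cQ * cL)) with hK₁
  set C₁ : ℝ := 18 * K₁ * (1 + 1 / β) with hC₁
  set C₂ : ℝ := (d₀ : ℝ) * (18 * (7 * CH * (d₀ : ℝ) / c')) / cL with hC₂
  have hK₁0 : 0 ≤ K₁ := by rw [hK₁]; positivity
  refine ⟨max 8000 (20 * d₀ + 100), min (min δQ δL) δH, lt_min (lt_min hδQ hδL) hδH, C₁ + C₂,
    fun t htδ htne N hN hNL => ?_⟩
  have hN8 : 8000 ≤ N := (le_max_left _ _).trans hN
  have hNd : 20 * d₀ + 100 ≤ N := (le_max_right _ _).trans hN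
  have hN0 : (0 : ℝ) < N := by exact_mod_cast (show 0 < N by omega)
  have htQ : |(t : ℝ) - 1 / 2| < δQ := htδ.trans_le ((min_le_left _ _).trans (min_le_left _ _))
  have htL : |(t : ℝ) - 1 / 2| < δL := htδ.trans_le ((min_le_left _ _).trans (min_le_right _ _))
  have htH : |(t : ℝ) - 1 / 2| < δH := htδ.trans_le (min_le_right _ _)
  -- `N ≤ L_ε(t) ≤ L(t, ε)`
  have hNLε : N ≤ charLength ε t := le_trans (by omega) hNL
  have hNW : N ≤ charLengthW ε t := hNLε.trans (charLength_le_charLengthW hε htne)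
  -- the facts at `t`, radii `≤ N`
  have hQt : ∀ R S : ℕ, 16 * r₀ < 4 * R → 4 * R < S → S ≤ N →
      cQ * (Q t r₀ R * Q t (4 * R) S) ≤ Q t r₀ S :=
    fun R S h1 h2 h3 => hQ t htQ r₀ R S hrQ h1 h2 fun _ => h3.trans hNW
  have hLt : ∀ m n : ℕ, rL ≤ m → m ≤ n → n ≤ N →
      cL * ((m : ℝ) / n) ^ (2 - β) ≤ Q t m n := by
    intro m n h1 h2 h3
    have h := hL t htL m n h1 h2 fun _ => h3.trans hNW
    refine le_trans (mul_le_mul_of_nonneg_left ?_ hcL.le) h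
    rcases Nat.eq_zero_or_pos m with hm | hm
    · subst hm
      simp only [CharP.cast_eq_zero, zero_div]
      rw [Real.zero_rpow (ne_of_gt (by linarith))]
      exact Real.rpow_nonneg le_rfl _
    · have hn : 0 < n := by omega
      apply Real.rpow_le_rpow_of_exponent_ge
      · exact div_pos (by exact_mod_cast hm) (by exact_mod_cast hn)
      · rw [div_le_one (by exact_mod_cast hn)]; exact_mod_cast h2
      · linarith
  have hHPt : ∀ m n : ℕ, n₀ ≤ m → m ≤ n → n ≤ N →
      (triSitePercolation t).real (domArmEvent ![true, false] m n upperHalfPlane) ≤ CH * ((m : ℝ) / n) :=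
    fun m n h1 h2 h3 => hHP t htH m n h1 h2 fun _ => h3.trans hNW
  obtain ⟨AN, hANdef⟩ : ∃ x : ℝ, x = (triSitePercolation t).real (triOneArm N) := ⟨_, rfl⟩
  obtain ⟨πN, hπNdef⟩ : ∃ x : ℝ, x = Q t r₀ N := ⟨_, rfl⟩
  have hpiv3 := fun {D k d' d₂ m₀ : ℕ} {v : Site 2} => @hpiv3Q t N D k d' d₂ m₀ r₀ v
  have hratio := fun {rL' : ℕ} {cQ' cL' β' : ℝ} => @kernel_le_ratio_mul (Q t) (hQ0 t) (hQa t) N r₀ rL' cQ' cL' β'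
  have hq0d : ∀ d : ℕ, 0 ≤ Q t r₀ d := fun d => hQ0 t r₀ d
  rw [← hANdef, ← hπNdef]
  obtain ⟨W, hWdef⟩ : ∃ x : ℝ, x = πN * AN := ⟨_, rfl⟩
  have hπN : 0 ≤ πN := by rw [hπNdef]; exact hQ0 t r₀ N
  have hAN : 0 ≤ AN := by rw [hANdef]; exact measureReal_nonneg
  have hW0 : 0 ≤ W := by rw [hWdef]; exact mul_nonneg hπN hAN
  -- `N² π̂(r₀, N) ≥ c_L`
  have hNπ : cL ≤ (N : ℝ) ^ 2 * πN := by
    have h := hLt r₀ N hrL (by omega) le_rfl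
    rw [← hπNdef] at h
    have hr0 : (0 : ℝ) < r₀ := by exact_mod_cast (show 0 < r₀ by omega)
    have hbase : (r₀ : ℝ) / N ≤ 1 := by rw [div_le_one hN0]; exact_mod_cast (show r₀ ≤ N by omega)
    have hb0 : (0 : ℝ) < (r₀ : ℝ) / N := div_pos hr0 hN0
    have h1 : ((r₀ : ℝ) / N) ^ (2 : ℝ) ≤ ((r₀ : ℝ) / N) ^ (2 - β) :=
      Real.rpow_le_rpow_of_exponent_ge hb0 hbase (by linarith)
    have h2 : (1 / (N : ℝ)) ^ 2 ≤ ((r₀ : ℝ) / N) ^ (2 : ℝ) := by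
      rw [Real.rpow_two]
      apply pow_le_pow_left₀ (by positivity)
      exact div_le_div_of_nonneg_right (by exact_mod_cast hr1) hN0.le
    have h3 : (N : ℝ) ^ 2 * (1 / (N : ℝ)) ^ 2 = 1 := by field_simp
    have h4 : cL = (N : ℝ) ^ 2 * (cL * (1 / (N : ℝ)) ^ 2) := by
      calc cL = cL * ((N : ℝ) ^ 2 * (1 / (N : ℝ)) ^ 2) := by rw [h3, mul_one]
        _ = (N : ℝ) ^ 2 * (cL * (1 / (N : ℝ)) ^ 2) := by ring
    calc cL = (N : ℝ) ^ 2 * (cL * (1 / (N : ℝ)) ^ 2) := h4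
      _ ≤ (N : ℝ) ^ 2 * (cL * ((r₀ : ℝ) / N) ^ (2 - β)) := by
          apply mul_le_mul_of_nonneg_left _ (by positivity)
          exact mul_le_mul_of_nonneg_left (h2.trans h1) hcL.le
      _ ≤ (N : ℝ) ^ 2 * πN := mul_le_mul_of_nonneg_left h (by positivity)
  obtain ⟨D, hD⟩ : ∃ D : ℕ, D = 2 * N / 5 := ⟨_, rfl⟩
  obtain ⟨M, hM⟩ : ∃ M : ℕ, M = 9 * N / 10 := ⟨_, rfl⟩
  -- one extension (scale `a = N/8 + 1 ≤ N`, `4a ≤ L_ε(t)` when `t < 1/2`)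
  have hextN : ∀ m₀ : ℕ, N ≤ 2 * m₀ + 2 → (triSitePercolation t).real (triOneArm m₀) ≤ 1 / c' * AN := by
    intro m₀ hm₀
    have h := hext t (N / 8 + 1) (by omega) (fun _ => by omega) m₀ N (by omega) (by omega)
    rw [← hANdef] at h
    rw [one_div, ← div_eq_inv_mul, le_div_iff₀' hc']
    exact h
  -- deep shells: `d' = N - k ≥ d₀`, three factors
  have hsite3 : ∀ k ∈ Finset.Ico (M + 1) (N - d₀ + 1), ∀ v ∈ triSphere k,
      (triSitePercolation t).real {ω | IsPivotal (triOneArm N) v ω} ≤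
        K₁ * (((N : ℝ) / ((N - k : ℕ) : ℝ)) ^ (2 - β) * (((N - k : ℕ) : ℝ) / N)) * W := by
    intro k hk v hv
    rw [Finset.mem_Ico] at hk
    rw [mem_triSphere_iff] at hv
    obtain ⟨d', hd'⟩ : ∃ d' : ℕ, d' = N - k := ⟨_, rfl⟩
    rw [← hd']
    have hkN' : k + d' = N := by omega
    have hdd : d₀ ≤ d' := by omega
    have hr₀d : r₀ ≤ d' := by omega
    have h2d : 2 * d' ≤ k := by omega
    have hD1 : 1 ≤ D := by omega
    have h2D : 2 * D ≤ k := by omega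
    have hm₀ : (k - D - 1) + D + 1 ≤ k := by omega
    have hrec : (d' + 1) + 2 * d' + 1 ≤ D := by omega
    have h3 := hpiv3 (D := D) (m₀ := k - D - 1) hv hkN' hr1 hr₀d h2d hD1 h2D hm₀ (le_refl (d' + 1)) hrec
    have hA := hextN (k - D - 1) (by omega)
    have hπ := hratio hcQ hcL hβ hβ2 hQt hLt (by omega) (by omega) (d := d') (by omega) (by omega) (by omega)
    rw [← hπNdef] at hπ
    have h2d1 : d' + 1 + d' = 2 * d' + 1 := by ring
    rw [h2d1] at h3
    have hhp : (triSitePercolation t).real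
        (domArmEvent ![true, false] (2 * d' + 1) (D - d') upperHalfPlane) ≤ 11 * CH * ((d' : ℝ) / N) := by
      refine (hHPt (2 * d' + 1) (D - d') (by omega) (by omega) (by omega)).trans ?_
      have := layer_ratio_le (N := N) (D := D) (d' := d') (by omega) hD (by omega) (by omega)
      calc CH * (((2 * d' + 1 : ℕ) : ℝ) / ((D - d' : ℕ) : ℝ)) ≤ CH * (11 * ((d' : ℝ) / N)) :=
            mul_le_mul_of_nonneg_left this hCH0
        _ = 11 * CH * ((d' : ℝ) / N) := by ring
    have hd'0 : (0 : ℝ) ≤ (d' : ℝ) / N := by positivity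
    have hX0 : (0 : ℝ) ≤ ((N : ℝ) / d') ^ (2 - β) := by positivity
    generalize ((N : ℝ) / d') ^ (2 - β) = X at hπ hX0 ⊢
    calc (triSitePercolation t).real {ω | IsPivotal (triOneArm N) v ω}
        ≤ (triSitePercolation t).real (triOneArm (k - D - 1)) * (Q t r₀ d' *
            (triSitePercolation t).real
              (domArmEvent ![true, false] (2 * d' + 1) (D - d') upperHalfPlane)) := h3
      _ ≤ (1 / c' * AN) * ((4 / (cQ * cL) * X * πN) * (11 * CH * ((d' : ℝ) / N))) := by
          refine mul_le_mul hA (mul_le_mul hπ hhp measureReal_nonneg (by positivity))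
            (mul_nonneg (hq0d d') measureReal_nonneg) (by positivity)
      _ = K₁ * (X * ((d' : ℝ) / N)) * W := by
          rw [hK₁, hWdef]; field_simp; ring
  -- shallow shells: `d' < d₀`, two factors
  have hsite2 : ∀ k ∈ Finset.Ico (N - d₀ + 1) (N + 1), ∀ v ∈ triSphere k,
      (triSitePercolation t).real {ω | IsPivotal (triOneArm N) v ω} ≤ 7 * CH * (d₀ : ℝ) / (c' * N) * AN := by
    intro k hk v hv
    rw [Finset.mem_Ico] at hk
    rw [mem_triSphere_iff] at hv
    obtain ⟨d', hd'⟩ : ∃ d' : ℕ, d' = N - k := ⟨_, rfl⟩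
    have hkN' : k + d' = N := by omega
    have hdd : d' < d₀ := by omega
    have hD1 : 1 ≤ D := by omega
    have h2D : 2 * D ≤ k := by omega
    have hm₀ : (k - D - 1) + D + 1 ≤ k := by omega
    have hd01 : 1 ≤ d₀ := by omega
    have hrec : d₀ + 2 * d' + 1 ≤ D := by omega
    have h2 := boundary_pivotal_two_le_mixed t (N := N) (D := D) (m₀ := k - D - 1) hv hkN' hD1 h2D hm₀
      hd01 hrec
    have hA := hextN (k - D - 1) (by omega)
    have hhp : (triSitePercolation t).real
        (domArmEvent ![true, false] (d₀ + d') (D - d') upperHalfPlane) ≤ 7 * CH * ((d₀ : ℝ) / N) := by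
      refine (hHPt (d₀ + d') (D - d') (by omega) (by omega) (by omega)).trans ?_
      have := layer_ratio_le' (N := N) (D := D) (d' := d') (d₀ := d₀) hNd hD hdd
      calc CH * ((((d₀ + d' : ℕ) : ℝ)) / ((D - d' : ℕ) : ℝ)) ≤ CH * (7 * ((d₀ : ℝ) / N)) :=
            mul_le_mul_of_nonneg_left this hCH0
        _ = 7 * CH * ((d₀ : ℝ) / N) := by ring
    calc (triSitePercolation t).real {ω | IsPivotal (triOneArm N) v ω}
        ≤ (triSitePercolation t).real (triOneArm (k - D - 1)) *
            (triSitePercolation t).real (domArmEvent ![true, false] (d₀ + d') (D - d') upperHalfPlane) := h2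
      _ ≤ (1 / c' * AN) * (7 * CH * ((d₀ : ℝ) / N)) :=
          mul_le_mul hA hhp measureReal_nonneg (by positivity)
      _ = 7 * CH * (d₀ : ℝ) / (c' * N) * AN := by field_simp
  -- split the layer into the two regimes and sum
  set P : Site 2 → ℝ := fun v => (triSitePercolation t).real {ω | IsPivotal (triOneArm N) v ω} with hP
  have hsplit : ∑ k ∈ Finset.Ico (M + 1) (N + 1), ∑ v ∈ triSphere k, P v =
      ∑ k ∈ Finset.Ico (M + 1) (N - d₀ + 1), ∑ v ∈ triSphere k, P v +
        ∑ k ∈ Finset.Ico (N - d₀ + 1) (N + 1), ∑ v ∈ triSphere k, P v :=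
    (Finset.sum_Ico_consecutive _ (by omega) (by omega)).symm
  have hsum3 := layer_sum_deep_le hK₁0 hW0 hβ hβ1 (by omega) (by omega) P hsite3
  have hB0 : 0 ≤ 7 * CH * (d₀ : ℝ) / (c' * N) * AN := by positivity
  have hsum2 := layer_sum_shallow_le (by omega) hB0 P hsite2
  have hcard : ((N + 1 - (N - d₀ + 1) : ℕ) : ℝ) = d₀ := by
    have : N + 1 - (N - d₀ + 1) = d₀ := by omega
    rw [this]
  rw [hcard] at hsum2
  have h1 : (1 : ℝ) ≤ (N : ℝ) ^ 2 * πN / cL := by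
    rw [le_div_iff₀ hcL, one_mul]; exact hNπ
  have hshallow : (d₀ : ℝ) * (18 * N * (7 * CH * (d₀ : ℝ) / (c' * N) * AN)) ≤ C₂ * ((N : ℝ) ^ 2 * W) := by
    have e1 : (d₀ : ℝ) * (18 * N * (7 * CH * (d₀ : ℝ) / (c' * N) * AN)) =
        (d₀ : ℝ) * (18 * (7 * CH * (d₀ : ℝ) / c')) * AN := by
      field_simp
    have e2 : C₂ * ((N : ℝ) ^ 2 * W) = (d₀ : ℝ) * (18 * (7 * CH * (d₀ : ℝ) / c')) *
        ((N : ℝ) ^ 2 * πN / cL * AN) := by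
      rw [hC₂, hWdef]; ring
    rw [e1, e2]
    have hc0 : 0 ≤ (d₀ : ℝ) * (18 * (7 * CH * (d₀ : ℝ) / c')) := by positivity
    apply mul_le_mul_of_nonneg_left _ hc0
    calc AN = 1 * AN := (one_mul _).symm
      _ ≤ (N : ℝ) ^ 2 * πN / cL * AN := mul_le_mul_of_nonneg_right h1 hAN
  rw [← hM]
  show ∑ k ∈ Finset.Ico (M + 1) (N + 1), ∑ v ∈ triSphere k, P v ≤ (C₁ + C₂) * ((N : ℝ) ^ 2 * πN) * AN
  rw [hsplit]
  calc _ ≤ 18 * K₁ * (1 + 1 / β) * ((N : ℝ) ^ 2 * W) + C₂ * ((N : ℝ) ^ 2 * W) :=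
        add_le_add hsum3 (hsum2.trans hshallow)
    _ = (C₁ + C₂) * ((N : ℝ) ^ 2 * πN) * AN := by rw [hC₁, hWdef]; ring

/-! ### (C) on both sides of `1/2`, generic kernel -/

/-- **The one-arm pivotal sum on both sides of `1/2`, generic kernel** (the tree's
`oneArmPivotalSum_le_twoSided` for a kernel `Q`; Werner 2009, Lecture 6, §5:
`Σ_x P_p(x pivotal for 0 ↔ ∂Λ_n) ≤ c n² π̂_p(n) P_p(0 ↔ ∂Λ_n)`; Nolin 2008, §6.2, proof of Thm. 27,
Case 1, eqs. (6.6)–(6.9), "uniformly in `P̂` between `P_p` and `P_{1-p}`"): from the four-arm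
quasi-multiplicativity, the a priori four-arm lower bound and the near-critical half-plane two-arm
bound, for every small `ε` and large `r₀` there are `n₁`, `δ > 0`, `C` with
`Σ_{v ∈ Λ_N} P_t(v pivotal for {0 ↔ ∂Λ_N}) ≤ C · N² Q_t(r₀, N) · P_t(0 ↔ ∂Λ_N)` for `|t - 1/2| < δ`,
`t ≠ 1/2`, `n₁ ≤ N`, `4N ≤ L_ε(t)` (bulk `oneArmPivotalSum_bulk_le_twoSided_gen` plus layer
`oneArmPivotalSum_layer_le_twoSided_gen`). [cite: WernerPCMI2009, Lecture 6, §5 ("Using differential inequalities for the one-arm event")] [cite: Nolin2008, §6.2, proof of Thm. 27, Case 1 (arXiv 0711.4948: Thm. 26)] -/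
theorem oneArmPivotalSum_le_twoSided_gen {Q : unitInterval → ℕ → ℕ → ℝ}
    (hQ0 : ∀ t r R, 0 ≤ Q t r R) (hQa : ∀ t r R R', r ≤ R → R ≤ R' → Q t r R' ≤ Q t r R)
    (hpivQ : ∀ (t : unitInterval) {N d r₀ m m' k : ℕ} {v : Site 2}, 1 ≤ r₀ → r₀ ≤ d → triNorm v = k →
      2 * d + 1 ≤ k → k + 2 * d ≤ N → m + d + 1 ≤ k → k + d + 1 ≤ m' → m' ≤ N →
      (triSitePercolation t).real {ω | IsPivotal (triOneArm N) v ω} ≤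
        (triSitePercolation t).real (triOneArm m) * (Q t r₀ d * (triSitePercolation t).real (armEvent ![true] m' N)))
    (hpiv3Q : ∀ (t : unitInterval) {N D k d' d₂ m₀ r₀ : ℕ} {v : Site 2}, triNorm v = k → k + d' = N →
      1 ≤ r₀ → r₀ ≤ d' → 2 * d' ≤ k → 1 ≤ D → 2 * D ≤ k → m₀ + D + 1 ≤ k → d' + 1 ≤ d₂ →
      d₂ + 2 * d' + 1 ≤ D →
      (triSitePercolation t).real {ω | IsPivotal (triOneArm N) v ω} ≤
        (triSitePercolation t).real (triOneArm m₀) * (Q t r₀ d' *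
          (triSitePercolation t).real (domArmEvent ![true, false] (d₂ + d') (D - d') upperHalfPlane)))
    (hQM2 : ∃ ε₁ > (0 : ℝ), ∀ ⦃ε : ℝ⦄, 0 < ε → ε < ε₁ →
      ∃ r₁ : ℕ, ∃ δ > (0 : ℝ), ∃ c > (0 : ℝ),
        ∀ t : unitInterval, |(t : ℝ) - 1 / 2| < δ →
          ∀ r R S : ℕ, r₁ ≤ r → 16 * r < 4 * R → 4 * R < S →
            ((t : ℝ) ≠ 1 / 2 → S ≤ charLengthW ε t) →
              c * (Q t r R * Q t (4 * R) S) ≤ Q t r S)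
    (hLB2 : ∃ ε₁ > (0 : ℝ), ∀ ⦃ε : ℝ⦄, 0 < ε → ε < ε₁ →
      ∃ r₁ : ℕ, ∃ δ > (0 : ℝ), ∃ β > (0 : ℝ), ∃ c > (0 : ℝ),
        ∀ t : unitInterval, |(t : ℝ) - 1 / 2| < δ →
          ∀ m n : ℕ, r₁ ≤ m → m ≤ n → ((t : ℝ) ≠ 1 / 2 → n ≤ charLengthW ε t) →
            c * ((m : ℝ) / n) ^ (2 - β) ≤ Q t m n) :
    ∃ ε₁ > (0 : ℝ), ∀ ⦃ε : ℝ⦄, 0 < ε → ε < ε₁ →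
      ∃ r₁ : ℕ, ∀ r₀ ≥ r₁, ∃ n₁ : ℕ, ∃ δ > (0 : ℝ), ∃ C : ℝ,
        ∀ t : unitInterval, |(t : ℝ) - 1 / 2| < δ → (t : ℝ) ≠ 1 / 2 →
          ∀ N : ℕ, n₁ ≤ N → 4 * N ≤ charLength ε t →
            oneArmPivotalSum t N ≤
              C * ((N : ℝ) ^ 2 * Q t r₀ N) * (triSitePercolation t).real (triOneArm N) := by
  obtain ⟨εB, hεB, HB⟩ := oneArmPivotalSum_bulk_le_twoSided_gen hQ0 hQa hpivQ hQM2 hLB2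
  obtain ⟨εY, hεY, HY⟩ := oneArmPivotalSum_layer_le_twoSided_gen hQ0 hQa hpiv3Q hQM2 hLB2
  refine ⟨min εB εY, lt_min hεB hεY, fun ε hε hε₁ => ?_⟩
  obtain ⟨rB, HB⟩ := HB hε (hε₁.trans_le (min_le_left _ _))
  obtain ⟨rY, HY⟩ := HY hε (hε₁.trans_le (min_le_right _ _))
  refine ⟨max rB rY, fun r₀ hr₀ => ?_⟩
  obtain ⟨nB, δB, hδB, CB, HB⟩ := HB r₀ ((le_max_left _ _).trans hr₀)
  obtain ⟨nY, δY, hδY, CY, HY⟩ := HY r₀ ((le_max_right _ _).trans hr₀)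
  refine ⟨max nB nY, min δB δY, lt_min hδB hδY, CB + CY, fun t htδ htne N hN hNL => ?_⟩
  have hB := HB t (htδ.trans_le (min_le_left _ _)) htne N ((le_max_left _ _).trans hN) hNL
  have hY := HY t (htδ.trans_le (min_le_right _ _)) htne N ((le_max_right _ _).trans hN) hNL
  have hsplit : oneArmPivotalSum t N =
      ∑ v ∈ triBall (9 * N / 10), (triSitePercolation t).real {ω | IsPivotal (triOneArm N) v ω} +
        ∑ k ∈ Finset.Ico (9 * N / 10 + 1) (N + 1), ∑ v ∈ triSphere k,
          (triSitePercolation t).real {ω | IsPivotal (triOneArm N) v ω} := by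
    rw [oneArmPivotalSum, sum_triBall_eq_sum_triSphere, sum_triBall_eq_sum_triSphere,
      Finset.range_eq_Ico, Finset.range_eq_Ico]
    exact (Finset.sum_Ico_consecutive _ (by omega) (by omega)).symm
  rw [hsplit, add_mul, add_mul]
  exact add_le_add hB hY

end Literature.Probability.Percolation
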